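import Literature.Geometry.Symplectic.PencilEndCoreFrame
import Literature.Topology.FourManifolds.SphereTubeOfFraming
import Literature.Topology.FourManifolds.SmoothEmbeddingCriteria
import Literature.Topology.FourManifolds.OrientedFrameAveraging
import HarnessLib

/-!
# The compactified pencil member has trivial normal bundle in the blown-up end

Topic `Literature/Geometry/Symplectic` (Stage C of the glue
`jPlanePencil_localFamily_homotopySphere ⟸ hls_localFoliation_embeddedSphere_trivialNormal`,
Wendl LNM 2216, proof of Prop. 2.53, p. 65).

For a member `u` of the pencil at `p` in a compact homotopy `4`-sphere `M` and a standard end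
`G : PencilEnd p`, the compactified member `c̃ = G.memberGlue u b : ℂℙ¹ → G.Y` (the member through
`inP` on the finite part, the exceptional point `inB (0, b)` at `∞`) is an embedded sphere
(`PencilEndMemberGlued.lean`). Here we build a **normal framing** of `c̃` in `Y` and deduce that its
image is the zero set of a submersion `π : N → ℂ` on an open neighbourhood `N` — the
trivial-normal-bundle hypothesis of `hls_localFoliation_embeddedSphere_trivialNormal`:

* on the finite part the framing interpolates, by a cutoff in `‖ξ‖`, between the (normalised)
  normal framing of the capped sphere `û ⊂ M` given by Kirby's Theorem VIII.2
  (`exists_normalFraming_of_homotopyEquiv_sphere_four`) and the far frame `∂_w` of the blown-up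
  coordinates (`farFrame`), which extends smoothly over `∞` as the constant frame
  `flatCx⁻¹ (0, c)` of the exceptional chart;
* it is complementary to the tangent planes: exactly so on the core (Kirby framing) and at `∞`,
  and on the interpolation zone because the tangent-killing functional of the flat coordinates
  takes both frames to positive multiples of `c` up to a small error
  (`eventually_tanKill_coreFrame`);
* the framed tubular neighbourhood theorem (`exists_isSmoothEmbedding_tube_of_isSmoothAlong`)
  then gives the tube `ν : ℂℙ¹ × ℝ² ↪ Y`, and `π = pr₂ ∘ ν⁻¹`.

## Main results

* `isSmoothAlong_of_local` — smoothness of a frame field along a map is a local, chart-wise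
  property;
* `PencilEnd.isSmoothAlong_memberFraming`, `PencilEnd.bijective_coprod_memberFraming`;
* `PencilEnd.exists_trivialNormal_memberGlue` — `(N, π)` as in the hypothesis of
  `hls_localFoliation_embeddedSphere_trivialNormal` for the compactified member.

## References

* C. Wendl, *Holomorphic Curves in Low Dimensions*, LNM 2216 (2018), proof of Prop. 2.53, p. 65.
  [Wendl2018]
* A. A. Kosinski, *Differential Manifolds* (1993), Ch. III §2. [Kosinski1993]
-/

noncomputable section

open scoped Manifold ContDiff Topology RealInnerProductSpace ComplexConjugate
open Set Function Metric Filter Literature.Topology.FourManifolds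
  Literature.Topology.FourManifolds.ComplexProjectiveSpace

namespace Literature.Geometry.Symplectic

/-! ### §1 Smoothness along a map is local -/

section Local

variable {EM : Type*} [NormedAddCommGroup EM] [NormedSpace ℝ EM] {HM : Type*} [TopologicalSpace HM]
  {IM : ModelWithCorners ℝ EM HM} {S : Type*} [TopologicalSpace S] [ChartedSpace HM S]
  {E : Type*} [NormedAddCommGroup E] [NormedSpace ℝ E]
  {X : Type*} [TopologicalSpace X] [ChartedSpace E X] [IsManifold 𝓘(ℝ, E) ∞ X]
  {F : Type*} [NormedAddCommGroup F] [NormedSpace ℝ F]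

/-- **Smoothness of a frame field along a smooth map is a local, chart-wise property**: if near
every point the field is smooth read in *some* chart containing the image point, it is smooth
read in every chart (cocycle `frameIn c N p = τ_{q → p}(c x) ∘ frameIn c N q`, and the chart change
is smooth along `c`). [folklore] -/
theorem isSmoothAlong_of_local {c : S → X} (hc : ContMDiff IM 𝓘(ℝ, E) ∞ c) {N : S → F →L[ℝ] E}
    (h : ∀ x : S, ∃ q : X, c x ∈ (chartAt E q).source ∧ ∃ U : Set S, IsOpen U ∧ x ∈ U ∧
      ContMDiffOn IM 𝓘(ℝ, F →L[ℝ] E) ∞ (frameIn c N q) U) :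
    IsSmoothAlong IM c N := by
  intro p x hx
  obtain ⟨q, hq, U, hUo, hxU, hU⟩ := h x
  -- on `U ∩ c⁻¹'(source p ∩ source q)` the reading in `p` is `τ_{q → p} ∘ (reading in q)`
  set V : Set S := U ∩ c ⁻¹' ((chartAt E q).source ∩ (chartAt E p).source) with hV
  have hVo : IsOpen V := hUo.inter (((chartAt E q).open_source.inter (chartAt E p).open_source).preimage
    hc.continuous)
  have hxV : x ∈ V := ⟨hxU, hq, hx⟩
  have h1 : ContMDiffOn IM 𝓘(ℝ, F →L[ℝ] E) ∞
      (fun y => (tangentCoordChange 𝓘(ℝ, E) q p (c y)).comp (frameIn c N q y)) V :=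
    ((contMDiffOn_tangentCoordChange_along hc q p).mono (fun y hy => hy.2)).clm_comp
      (hU.mono fun y hy => hy.1)
  have h2 : ContMDiffOn IM 𝓘(ℝ, F →L[ℝ] E) ∞ (frameIn c N p) V :=
    h1.congr fun y hy => (tangentCoordChange_comp_frameIn N hy.2.1 hy.2.2).symm
  exact (h2.contMDiffAt (hVo.mem_nhds hxV)).contMDiffWithinAt

end Local

/-! ### §2 Linear algebra: complementary frames, and the class equation -/

section LinearAlgebra

/-- **A frame complementary to an immersed plane gives an isomorphism** `ℝ² × ℝ² → ℝ⁴`: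
if `f` is injective and `N c ∈ range f ⇒ c = 0` then `f ⊕ N` is bijective (injective, hence
bijective by dimension). [folklore] -/
theorem bijective_coprod_of_eq {f N : EuclideanSpace ℝ (Fin 2) →L[ℝ] EuclideanSpace ℝ (Fin 4)}
    (hf : Injective f) (hN : ∀ c a, N c = f a → c = 0) : Bijective (f.coprod N) := by
  have hinj : Injective (f.coprod N) := by
    rintro ⟨a₁, c₁⟩ ⟨a₂, c₂⟩ h
    rw [ContinuousLinearMap.coprod_apply, ContinuousLinearMap.coprod_apply] at h
    have h' : N c₁ - N c₂ = f a₂ - f a₁ := sub_eq_sub_iff_add_eq_add.2 (by rw [add_comm]; exact h)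
    rw [← map_sub, ← map_sub] at h'
    have hc : c₁ = c₂ := sub_eq_zero.1 (hN _ _ h')
    subst hc
    have ha : a₁ = a₂ := hf (add_right_cancel h)
    subst ha
    rfl
  refine ⟨hinj, ?_⟩
  have hdim : Module.finrank ℝ (EuclideanSpace ℝ (Fin 2) × EuclideanSpace ℝ (Fin 2)) =
      Module.finrank ℝ (EuclideanSpace ℝ (Fin 4)) := by
    rw [Module.finrank_prod, finrank_euclideanSpace_fin, finrank_euclideanSpace_fin]
  exact (LinearMap.injective_iff_surjective_of_finrank_eq_finrank
    (f := (f.coprod N).toLinearMap) hdim).1 hinj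

/-- **The class equation has only the trivial solution**: if
`((1 − χ) μ) (w + E) + χ z' w = 0` with `0 ≤ χ ≤ 1`, `μ > 0`, `‖z' − 1‖ ≤ 1/4` and `‖E‖ ≤ ‖w‖/4`,
then `w = 0` (the coefficient `(1 − χ) μ + χ z'` has real part `≥ (1 − χ) μ + 3χ/4`, which beats
the error `(1 − χ) μ/4`). [folklore] -/
theorem eq_zero_of_classEquation {χ μ : ℝ} (hχ0 : 0 ≤ χ) (hχ1 : χ ≤ 1) (hμ : 0 < μ) {zd : ℂ}
    (hzd : ‖zd - 1‖ ≤ 1 / 4) {w E : ℂ} (hE : ‖E‖ ≤ ‖w‖ / 4)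
    (h : (((1 - χ) * μ : ℝ) : ℂ) * (w + E) + (χ : ℂ) * (zd * w) = 0) : w = 0 := by
  -- the coefficient and its real part
  set q : ℂ := (((1 - χ) * μ : ℝ) : ℂ) + (χ : ℂ) * zd with hq
  have key : q * w = -((((1 - χ) * μ : ℝ) : ℂ) * E) := by
    rw [hq]; linear_combination h
  have hre : (1 - χ) * μ + χ * (3 / 4) ≤ ‖q‖ := by
    have h1 : q.re = (1 - χ) * μ + χ * zd.re := by
      rw [hq]; simp [Complex.add_re, Complex.mul_re, Complex.ofReal_re, Complex.ofReal_im]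
    have h2 : 3 / 4 ≤ zd.re := by
      have h3 : |(zd - 1).re| ≤ ‖zd - 1‖ := Complex.abs_re_le_norm (zd - 1)
      have h4 : (zd - 1).re = zd.re - 1 := by simp
      rw [h4] at h3
      have := (abs_le.1 (h3.trans hzd)).1
      linarith
    have h5 : q.re ≤ ‖q‖ := Complex.re_le_norm q
    nlinarith
  -- norms of the two sides
  have hn : ‖q‖ * ‖w‖ ≤ (1 - χ) * μ * (‖w‖ / 4) := by
    have h1 : ‖q * w‖ = ‖(((1 - χ) * μ : ℝ) : ℂ) * E‖ := by rw [key, norm_neg]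
    rw [norm_mul, norm_mul, Complex.norm_real, Real.norm_eq_abs,
      abs_of_nonneg (by nlinarith : (0 : ℝ) ≤ (1 - χ) * μ)] at h1
    rw [h1]
    exact mul_le_mul_of_nonneg_left hE (by nlinarith)
  have hw : ((1 - χ) * μ * (3 / 4) + χ * (3 / 4)) * ‖w‖ ≤ 0 := by
    nlinarith [norm_nonneg w]
  have hpos : 0 < (1 - χ) * μ * (3 / 4) + χ * (3 / 4) := by
    rcases eq_or_lt_of_le hχ1 with h1 | h1
    · rw [h1]; norm_num
    · nlinarith
  have hw0 : ‖w‖ ≤ 0 := by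
    by_contra hcon
    push Not at hcon
    nlinarith
  exact norm_le_zero_iff.1 hw0

end LinearAlgebra

/-! ### §3 The plane cutoff and the frames -/

section Frames

/-- **The cutoff on the plane** `χ_R`: `0` on `‖ξ‖ ≤ R`, `1` on `‖ξ‖ ≥ 2R`, smooth, values in `[0, 1]`.
[folklore] -/
def planeCutoff (R : ℝ) (ξ : ℂ) : ℝ := Real.smoothTransition ((‖ξ‖ ^ 2 - R ^ 2) / (3 * R ^ 2))

/-- `χ_R = 0` on the disc of radius `R`. [folklore] -/
theorem planeCutoff_of_norm_le {R : ℝ} (hR : 0 < R) {ξ : ℂ} (h : ‖ξ‖ ≤ R) : planeCutoff R ξ = 0 := by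
  apply Real.smoothTransition.zero_of_nonpos
  apply div_nonpos_of_nonpos_of_nonneg
  · nlinarith [norm_nonneg ξ]
  · positivity

/-- `χ_R = 1` outside the disc of radius `2R`. [folklore] -/
theorem planeCutoff_of_le_norm {R : ℝ} (hR : 0 < R) {ξ : ℂ} (h : 2 * R ≤ ‖ξ‖) : planeCutoff R ξ = 1 := by
  apply Real.smoothTransition.one_of_one_le
  rw [le_div_iff₀ (by positivity)]
  nlinarith [norm_nonneg ξ]

/-- `0 ≤ χ_R`. [folklore] -/
theorem planeCutoff_nonneg (R : ℝ) (ξ : ℂ) : 0 ≤ planeCutoff R ξ := Real.smoothTransition.nonneg _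

/-- `χ_R ≤ 1`. [folklore] -/
theorem planeCutoff_le_one (R : ℝ) (ξ : ℂ) : planeCutoff R ξ ≤ 1 := Real.smoothTransition.le_one _

/-- `χ_R` is smooth. [folklore] -/
theorem contDiff_planeCutoff (R : ℝ) : ContDiff ℝ ∞ (planeCutoff R) :=
  Real.smoothTransition.contDiff.comp
    (((contDiff_norm_sq ℝ).sub contDiff_const).div_const _)

variable {M : Type} [TopologicalSpace M] [T2Space M] [ChartedSpace (EuclideanSpace ℝ (Fin 4)) M]

/-- **The frame on the finite part**: the convex interpolation, by the cutoff `χ_R(ξ)`, between the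
renormalised `M`-framing `N(σ₀ ξ) ∘ A` of the capped sphere and the far frame.
[cite: Wendl2018, proof of Prop. 2.53 (p. 65)] -/
def finiteFrame (p : M) (u : ℂ → punctured p)
    (N : ComplexProjectiveSpace 1 → EuclideanSpace ℝ (Fin 2) →L[ℝ] EuclideanSpace ℝ (Fin 4))
    (A : EuclideanSpace ℝ (Fin 2) →L[ℝ] EuclideanSpace ℝ (Fin 2)) (R : ℝ) (ξ : ℂ) :
    EuclideanSpace ℝ (Fin 2) →L[ℝ] EuclideanSpace ℝ (Fin 4) :=
  (1 - planeCutoff R ξ) • ((N (CodimTwoData.linePt 0 ξ)).comp A) + planeCutoff R ξ • farFrame p u ξ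

/-- **The frame at infinity**: the constant frame `c ↦ flatCx⁻¹ (0, c)` of the exceptional chart.
[folklore] -/
def infFrame : EuclideanSpace ℝ (Fin 2) →L[ℝ] EuclideanSpace ℝ (Fin 4) :=
  (flatCx.symm : ℂ × ℂ →L[ℝ] EuclideanSpace ℝ (Fin 4)).comp
    (inrC.comp (e2c : EuclideanSpace ℝ (Fin 2) →L[ℝ] ℂ))

/-- Values of the frame at infinity. [folklore] -/
@[simp] theorem infFrame_apply (c : EuclideanSpace ℝ (Fin 2)) : infFrame c = flatCx.symm (0, e2c c) := rfl

open Classical in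
/-- **The normal framing of the compactified member** along `ℂℙ¹`: `finiteFrame` in the affine
coordinate on the finite part, `infFrame` at `∞`. [cite: Wendl2018, proof of Prop. 2.53 (p. 65)] -/
def memberFraming (p : M) (u : ℂ → punctured p)
    (N : ComplexProjectiveSpace 1 → EuclideanSpace ℝ (Fin 2) →L[ℝ] EuclideanSpace ℝ (Fin 4))
    (A : EuclideanSpace ℝ (Fin 2) →L[ℝ] EuclideanSpace ℝ (Fin 2)) (R : ℝ)
    (y : ComplexProjectiveSpace 1) : EuclideanSpace ℝ (Fin 2) →L[ℝ] EuclideanSpace ℝ (Fin 4) :=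
  if CoordNeZero 0 y then finiteFrame p u N A R (affineCoordComplex 0 y 0) else infFrame

variable {p : M} {u : ℂ → punctured p}
  {N : ComplexProjectiveSpace 1 → EuclideanSpace ℝ (Fin 2) →L[ℝ] EuclideanSpace ℝ (Fin 4)}
  {A : EuclideanSpace ℝ (Fin 2) →L[ℝ] EuclideanSpace ℝ (Fin 2)} {R : ℝ}

/-- The framing on the finite part. [folklore] -/
theorem memberFraming_of_coordNeZero {y : ComplexProjectiveSpace 1} (hy : CoordNeZero 0 y) :
    memberFraming p u N A R y = finiteFrame p u N A R (affineCoordComplex 0 y 0) := by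
  simp [memberFraming, hy]

/-- The framing at `∞`. [folklore] -/
theorem memberFraming_of_not_coordNeZero {y : ComplexProjectiveSpace 1} (hy : ¬ CoordNeZero 0 y) :
    memberFraming p u N A R y = infFrame := by
  simp [memberFraming, hy]

/-- On the core disc `‖ξ‖ ≤ R` the frame is the renormalised `M`-framing. [folklore] -/
theorem finiteFrame_of_norm_le (hR : 0 < R) {ξ : ℂ} (h : ‖ξ‖ ≤ R) :
    finiteFrame p u N A R ξ = (N (CodimTwoData.linePt 0 ξ)).comp A := by
  rw [finiteFrame, planeCutoff_of_norm_le hR h]; module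

/-- Far out, `‖ξ‖ ≥ 2R`, the frame is the far frame. [folklore] -/
theorem finiteFrame_of_le_norm (hR : 0 < R) {ξ : ℂ} (h : 2 * R ≤ ‖ξ‖) :
    finiteFrame p u N A R ξ = farFrame p u ξ := by
  rw [finiteFrame, planeCutoff_of_le_norm hR h]; module

/-- Values of the finite frame. [folklore] -/
theorem finiteFrame_apply (ξ : ℂ) (c : EuclideanSpace ℝ (Fin 2)) :
    finiteFrame p u N A R ξ c =
      (1 - planeCutoff R ξ) • N (CodimTwoData.linePt 0 ξ) (A c) + planeCutoff R ξ • farFrame p u ξ c := rfl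

end Frames

/-! ### §4 Readings of the framing in the charts of `Y` -/

namespace PencilEnd

variable {M : Type} [TopologicalSpace M] [T2Space M] [ChartedSpace (EuclideanSpace ℝ (Fin 4)) M]
  [IsManifold (𝓡 4) ∞ M] {p : M} (G : PencilEnd p)
  {J : ∀ x : punctured p, TangentSpace (𝓡 4) x →L[ℝ] TangentSpace (𝓡 4) x}
  {u : ℂ → punctured p} {b : ℂ}
  {N : ComplexProjectiveSpace 1 → EuclideanSpace ℝ (Fin 2) →L[ℝ] EuclideanSpace ℝ (Fin 4)}
  {A : EuclideanSpace ℝ (Fin 2) →L[ℝ] EuclideanSpace ℝ (Fin 2)} {R : ℝ}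

/-- The `M`-framing of the capped sphere read in the chart at `a'`, at a finite point.
[folklore] -/
theorem frameIn_capGlue_of_coordNeZero {y : ComplexProjectiveSpace 1} (hy : CoordNeZero 0 y)
    (a' : M) :
    frameIn (capGlue u) N a' y =
      (tangentCoordChange (𝓡 4) (u (affineCoordComplex 0 y 0)).1 a'
        (u (affineCoordComplex 0 y 0)).1).comp (N y) := by
  rw [frameIn, capGlue_of_coordNeZero_zero hy]

/-- **The framing read in a chart `inP a` of `Y`, at a finite point**: the interpolation of the
`M`-framing of the capped sphere read in the chart at `a` and the far frame read there.
[folklore] -/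
theorem frameIn_memberGlue_inP {y : ComplexProjectiveSpace 1} (hy : CoordNeZero 0 y)
    (a : punctured p) :
    frameIn (G.memberGlue u b) (memberFraming p u N A R) (G.inP a) y =
      (1 - planeCutoff R (affineCoordComplex 0 y 0)) • ((frameIn (capGlue u) N a.1 y).comp A) +
        planeCutoff R (affineCoordComplex 0 y 0) •
          ((tangentCoordChange (𝓡 4) (u (affineCoordComplex 0 y 0)).1 a.1
            (u (affineCoordComplex 0 y 0)).1).comp (farFrame p u (affineCoordComplex 0 y 0))) := by
  set ξ := affineCoordComplex 0 y 0 with hξ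
  have hτ : tangentCoordChange (𝓡 4) (G.memberGlue u b y) (G.inP a) (G.memberGlue u b y) =
      tangentCoordChange (𝓡 4) (u ξ).1 a.1 (u ξ).1 := by
    rw [G.memberGlue_of_coordNeZero_zero hy, G.tangentCoordChange_inP,
      TopologicalSpace.Opens.tangentCoordChange_coe _ (mem_chart_source _ (u ξ))]
  have hN : N (CodimTwoData.linePt 0 ξ) = N y := by
    rw [hξ, CodimTwoData.linePt_affineCoordComplex hy]
  ext1 c
  rw [frameIn_apply, hτ, memberFraming_of_coordNeZero hy, finiteFrame_apply, map_add, map_smul,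
    map_smul, hN]
  simp [frameIn_capGlue_of_coordNeZero hy, hξ]

/-- **The framing read in the exceptional chart is the constant frame far out**: at a finite
point with `u ξ` in the gluing region and `‖ξ‖ ≥ 2R`. [folklore] -/
theorem frameIn_memberGlue_inB_of_le_norm (hR : 0 < R) {q : G.box} (hq : (q : ℂ × ℂ).1 = 0)
    {y : ComplexProjectiveSpace 1} (hy : CoordNeZero 0 y)
    (hsrc : u (affineCoordComplex 0 y 0) ∈ G.src) (hfar : 2 * R ≤ ‖affineCoordComplex 0 y 0‖) :
    frameIn (G.memberGlue u b) (memberFraming p u N A R) (G.inB q) y = infFrame := by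
  ext1 c
  rw [frameIn_apply, G.memberGlue_of_coordNeZero_zero hy, memberFraming_of_coordNeZero hy,
    finiteFrame_of_le_norm hR hfar, G.exceptionalReading_farFrame hq hsrc, infFrame_apply]

/-- **The framing read in the exceptional chart at `∞` is the constant frame.** [folklore] -/
theorem frameIn_memberGlue_inB_inf {q : G.box} (hq : (q : ℂ × ℂ).1 = 0) (hb : ‖b - G.b₀‖ < G.ρ')
    {y : ComplexProjectiveSpace 1} (hy : ¬ CoordNeZero 0 y) :
    frameIn (G.memberGlue u b) (memberFraming p u N A R) (G.inB q) y = infFrame := by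
  have hc : G.memberGlue u b y = G.inB ⟨((0 : ℂ), b), G.zero_intercept_mem_box hb⟩ := by
    rw [(G.memberGlue_of_not_coordNeZero_zero hy).1, G.inBox_of_mem (G.zero_intercept_mem_box hb)]
  ext1 c
  rw [frameIn_apply, hc, memberFraming_of_not_coordNeZero hy,
    G.tangentCoordChange_inB_inB rfl hq (mem_extChartAt_source _)]

/-! ### §5 The framing is smooth along the compactified member -/

omit [T2Space M] [ChartedSpace (EuclideanSpace ℝ (Fin 4)) M] [IsManifold (𝓡 4) ∞ M] in
/-- Open conditions on the affine coordinate define open subsets of the finite part of `ℂℙ¹`.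
[folklore] -/
theorem isOpen_setOf_coordNeZero_and {P : Set ℂ} (hP : IsOpen P) :
    IsOpen {y : ComplexProjectiveSpace 1 | CoordNeZero 0 y ∧ affineCoordComplex 0 y 0 ∈ P} :=
  (continuousOn_affineCoordComplex_apply 0).isOpen_inter_preimage (isOpen_setOf_coordNeZero 0) hP

omit [T2Space M] [ChartedSpace (EuclideanSpace ℝ (Fin 4)) M] [IsManifold (𝓡 4) ∞ M] in
/-- The affine coordinate is `C^∞` on the finite part (literal model `𝓡 2`). [folklore] -/
theorem contMDiffOn_affineCoordComplex_zero :
    ContMDiffOn (𝓡 2) 𝓘(ℝ, ℂ) ∞ (fun y : ComplexProjectiveSpace 1 => affineCoordComplex 0 y 0)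
      {y | CoordNeZero 0 y} := by
  have h := contMDiffOn_affineCoordComplex (0 : Fin 2)
  exact h

omit [T2Space M] [ChartedSpace (EuclideanSpace ℝ (Fin 4)) M] [IsManifold (𝓡 4) ∞ M] in
/-- The affine coordinate is differentiable at finite points. [folklore] -/
theorem hasMFDerivAt_affineCoordComplex_zero {y : ComplexProjectiveSpace 1} (hy : CoordNeZero 0 y) :
    HasMFDerivAt (𝓡 2) 𝓘(ℝ, ℂ) (fun y : ComplexProjectiveSpace 1 => affineCoordComplex 0 y 0) y
      (mfderiv (𝓡 2) 𝓘(ℝ, ℂ) (fun y : ComplexProjectiveSpace 1 => affineCoordComplex 0 y 0) y) :=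
  ((contMDiffOn_affineCoordComplex_zero.contMDiffAt
    ((isOpen_setOf_coordNeZero 0).mem_nhds hy)).mdifferentiableAt (by simp)).hasMFDerivAt

/-- **The framing is smooth read in a chart `inP a`**, on the finite points whose member point
lies in the chart domain of `a` (`R₀ < R`: the far frame is only used where `u ξ` is in the
gluing region). [folklore] -/
theorem contMDiffOn_frameIn_memberGlue_inP (hu : IsPencilPlane J u b)
    (hN : IsSmoothAlong (𝓡 2) (capGlue u) N) (hR : 0 < R) {R₀ : ℝ} (hR₀ : R₀ < R)
    (hsrc : ∀ ξ : ℂ, R₀ < ‖ξ‖ → u ξ ∈ G.src) (a : punctured p) :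
    ContMDiffOn (𝓡 2) 𝓘(ℝ, EuclideanSpace ℝ (Fin 2) →L[ℝ] EuclideanSpace ℝ (Fin 4)) ∞
      (frameIn (G.memberGlue u b) (memberFraming p u N A R) (G.inP a))
      {y | CoordNeZero 0 y ∧
        (u (affineCoordComplex 0 y 0)).1 ∈ (chartAt (EuclideanSpace ℝ (Fin 4)) a.1).source} := by
  set κ : ComplexProjectiveSpace 1 → ℂ := fun y => affineCoordComplex 0 y 0 with hκ
  set W : Set (ComplexProjectiveSpace 1) :=
    {y | CoordNeZero 0 y ∧ (u (κ y)).1 ∈ (chartAt (EuclideanSpace ℝ (Fin 4)) a.1).source} with hW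
  have hPo : IsOpen {ξ : ℂ | (u ξ).1 ∈ (chartAt (EuclideanSpace ℝ (Fin 4)) a.1).source} :=
    (chartAt (EuclideanSpace ℝ (Fin 4)) a.1).open_source.preimage
      (continuous_subtype_val.comp hu.continuous)
  have hWo : IsOpen W := isOpen_setOf_coordNeZero_and hPo
  have hκs : ContMDiffOn (𝓡 2) 𝓘(ℝ, ℂ) ∞ κ W :=
    contMDiffOn_affineCoordComplex_zero.mono fun y hy => hy.1
  have hχ : ContMDiff 𝓘(ℝ, ℂ) 𝓘(ℝ, ℝ) ∞ (planeCutoff R) := (contDiff_planeCutoff R).contMDiff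
  -- term 1: `(1 - χ) • (frameIn û N a) ∘ A`
  have h1 : ContMDiffOn (𝓡 2) 𝓘(ℝ, ℝ) ∞ (fun y => 1 - planeCutoff R (κ y)) W :=
    contMDiffOn_const.sub (hχ.comp_contMDiffOn hκs)
  have h2 : ContMDiffOn (𝓡 2) 𝓘(ℝ, EuclideanSpace ℝ (Fin 2) →L[ℝ] EuclideanSpace ℝ (Fin 4)) ∞
      (fun y => (frameIn (capGlue u) N a.1 y).comp A) W := by
    refine ((hN a.1).mono fun y hy => ?_).clm_comp contMDiffOn_const
    show capGlue u y ∈ (chartAt (EuclideanSpace ℝ (Fin 4)) a.1).source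
    rw [capGlue_of_coordNeZero_zero hy.1]; exact hy.2
  -- term 2: `χ • τ ∘ farFrame`, locally zero on the core and smooth on the gluing region
  have h3 : ContMDiffOn (𝓡 2) 𝓘(ℝ, EuclideanSpace ℝ (Fin 2) →L[ℝ] EuclideanSpace ℝ (Fin 4)) ∞
      (fun y => planeCutoff R (κ y) • ((tangentCoordChange (𝓡 4) (u (κ y)).1 a.1 (u (κ y)).1).comp
        (farFrame p u (κ y)))) W := by
    intro y hy
    by_cases hlt : ‖κ y‖ < R
    · -- locally zero
      have hO : IsOpen {y' : ComplexProjectiveSpace 1 | CoordNeZero 0 y' ∧ κ y' ∈ ball (0 : ℂ) R} :=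
        isOpen_setOf_coordNeZero_and isOpen_ball
      have hyO : y ∈ {y' : ComplexProjectiveSpace 1 | CoordNeZero 0 y' ∧ κ y' ∈ ball (0 : ℂ) R} :=
        ⟨hy.1, by simpa using hlt⟩
      have hz : ContMDiffOn (𝓡 2) 𝓘(ℝ, EuclideanSpace ℝ (Fin 2) →L[ℝ] EuclideanSpace ℝ (Fin 4)) ∞
          (fun y => planeCutoff R (κ y) • ((tangentCoordChange (𝓡 4) (u (κ y)).1 a.1 (u (κ y)).1).comp
            (farFrame p u (κ y))))
          {y' : ComplexProjectiveSpace 1 | CoordNeZero 0 y' ∧ κ y' ∈ ball (0 : ℂ) R} := by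
        refine (contMDiffOn_const
          (c := (0 : EuclideanSpace ℝ (Fin 2) →L[ℝ] EuclideanSpace ℝ (Fin 4)))).congr fun y' hy' => ?_
        have : ‖κ y'‖ ≤ R := by have := hy'.2; rw [mem_ball_zero_iff] at this; exact this.le
        rw [planeCutoff_of_norm_le hR this]
        exact zero_smul ℝ ((tangentCoordChange (𝓡 4) (u (κ y')).1 a.1 (u (κ y')).1).comp
          (farFrame p u (κ y')))
      exact (hz.contMDiffAt (hO.mem_nhds hyO)).contMDiffWithinAt
    · -- on the gluing region
      have hle : R ≤ ‖κ y‖ := not_lt.1 hlt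
      set O : Set (ComplexProjectiveSpace 1) := {y' | CoordNeZero 0 y' ∧ κ y' ∈
        {ξ : ℂ | R₀ < ‖ξ‖ ∧ (u ξ).1 ∈ (chartAt (EuclideanSpace ℝ (Fin 4)) a.1).source}} with hO
      have hOo : IsOpen O := isOpen_setOf_coordNeZero_and ((isOpen_lt continuous_const continuous_norm).inter hPo)
      have hyO : y ∈ O := ⟨hy.1, lt_of_lt_of_le hR₀ hle, hy.2⟩
      have hfar := G.contMDiffOn_chartReading_farFrame hu.contMDiff (a.1 : M)
      have hκO : ContMDiffOn (𝓡 2) 𝓘(ℝ, ℂ) ∞ κ O := contMDiffOn_affineCoordComplex_zero.mono fun y hy => hy.1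
      have hcomp : ContMDiffOn (𝓡 2) 𝓘(ℝ, EuclideanSpace ℝ (Fin 2) →L[ℝ] EuclideanSpace ℝ (Fin 4)) ∞
          (fun y => (tangentCoordChange (𝓡 4) (u (κ y)).1 a.1 (u (κ y)).1).comp (farFrame p u (κ y))) O :=
        hfar.comp hκO fun y' hy' => ⟨hsrc _ hy'.2.1, hy'.2.2⟩
      have hprod := ((hχ.comp_contMDiffOn hκO).smul hcomp)
      exact (hprod.contMDiffAt (hOo.mem_nhds hyO)).contMDiffWithinAt
  refine ((h1.smul h2).add h3).congr fun y hy => ?_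
  exact G.frameIn_memberGlue_inP hy.1 a

omit [IsManifold (𝓡 4) ∞ M] in
/-- The neighbourhood of `∞` outside the closed disc `σ₀(‖ξ‖ ≤ 2R)` is open and contains `∞`.
[folklore] -/
theorem isOpen_compl_linePt_image (R : ℝ) :
    IsOpen (CodimTwoData.linePt 0 '' closedBall (0 : ℂ) (2 * R))ᶜ ∧
      CodimTwoData.linePt 1 0 ∈ (CodimTwoData.linePt 0 '' closedBall (0 : ℂ) (2 * R))ᶜ := by
  refine ⟨((isCompact_closedBall (0 : ℂ) (2 * R)).image
    (CodimTwoData.continuous_linePt 0)).isClosed.isOpen_compl, ?_⟩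
  rintro ⟨z, -, hz⟩
  have h := CodimTwoData.coordNeZero_linePt 0 z
  rw [hz] at h
  exact CodimTwoData.not_coordNeZero_zero_linePt_one_zero h

/-- **The framing read in the exceptional chart is constant near `∞`.** [folklore] -/
theorem frameIn_memberGlue_inB_eq_infFrame (hR : 0 < R) {R₀ : ℝ} (hR₀ : R₀ < R)
    (hsrc : ∀ ξ : ℂ, R₀ < ‖ξ‖ → u ξ ∈ G.src) (hb : ‖b - G.b₀‖ < G.ρ')
    {q : G.box} (hq : (q : ℂ × ℂ).1 = 0) {y : ComplexProjectiveSpace 1}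
    (hy : y ∈ (CodimTwoData.linePt 0 '' closedBall (0 : ℂ) (2 * R))ᶜ) :
    frameIn (G.memberGlue u b) (memberFraming p u N A R) (G.inB q) y = infFrame := by
  by_cases h0 : CoordNeZero 0 y
  · have hfar : 2 * R ≤ ‖affineCoordComplex 0 y 0‖ := by
      by_contra hlt
      push Not at hlt
      exact hy ⟨affineCoordComplex 0 y 0, by rw [mem_closedBall, dist_zero_right]; exact hlt.le,
        CodimTwoData.linePt_affineCoordComplex h0⟩
    have hsrc' : u (affineCoordComplex 0 y 0) ∈ G.src := hsrc _ (by linarith)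
    exact G.frameIn_memberGlue_inB_of_le_norm hR hq h0 hsrc' hfar
  · exact G.frameIn_memberGlue_inB_inf hq hb h0

variable [CompactSpace M]

/-- **The normal framing of the compactified member is smooth along it** (in the sense of
`IsSmoothAlong`: read in every chart of `Y`). [cite: Wendl2018, proof of Prop. 2.53 (p. 65)] -/
theorem isSmoothAlong_memberFraming (hu : IsPencilPlane J u b) (hb : ‖b - G.b₀‖ < G.ρ')
    (hJstd : ∀ x : punctured p, InPuncturedChartBall p G.rad x →
      ∀ (v : TangentSpace (𝓡 4) x) (c : EuclideanSpace ℝ (Fin 4)),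
        inner ℝ (fderiv ℝ inversion (extChartAt (𝓡 4) p x.1 - extChartAt (𝓡 4) p p)
          (mfderiv (𝓡 4) 𝓘(ℝ, EuclideanSpace ℝ (Fin 4))
            (fun z : punctured p => extChartAt (𝓡 4) p z.1) x (J x v))) c
        = stdSymplecticForm (fderiv ℝ inversion (extChartAt (𝓡 4) p x.1 - extChartAt (𝓡 4) p p)
          (mfderiv (𝓡 4) 𝓘(ℝ, EuclideanSpace ℝ (Fin 4))
            (fun z : punctured p => extChartAt (𝓡 4) p z.1) x v)) c)
    (hN : IsSmoothAlong (𝓡 2) (capGlue u) N) (hR : 0 < R) {R₀ : ℝ} (hR₀ : R₀ < R)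
    (hsrc : ∀ ξ : ℂ, R₀ < ‖ξ‖ → u ξ ∈ G.src) :
    IsSmoothAlong (𝓡 2) (G.memberGlue u b) (memberFraming p u N A R) := by
  refine isSmoothAlong_of_local (G.memberGlue_smooth_injective_immersion hu hb hJstd).1 fun y => ?_
  by_cases hy : CoordNeZero 0 y
  · refine ⟨G.inP (u (affineCoordComplex 0 y 0)), ?_, _, ?_, ?_,
      G.contMDiffOn_frameIn_memberGlue_inP hu hN hR hR₀ hsrc (u (affineCoordComplex 0 y 0))⟩
    · rw [G.memberGlue_of_coordNeZero_zero hy]; exact mem_chart_source _ _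
    · exact isOpen_setOf_coordNeZero_and ((chartAt (EuclideanSpace ℝ (Fin 4))
        (u (affineCoordComplex 0 y 0)).1).open_source.preimage
          (continuous_subtype_val.comp hu.continuous))
    · exact ⟨hy, mem_chart_source _ _⟩
  · obtain ⟨hUo, hinf⟩ := isOpen_compl_linePt_image R
    refine ⟨G.inB ⟨((0 : ℂ), b), G.zero_intercept_mem_box hb⟩, ?_, _, hUo, ?_, ?_⟩
    · rw [(G.memberGlue_of_not_coordNeZero_zero hy).1, G.inBox_of_mem (G.zero_intercept_mem_box hb)]
      exact mem_chart_source _ _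
    · rw [CodimTwoData.eq_linePt_one_zero hy]; exact hinf
    · exact contMDiffOn_const.congr fun y' hy' =>
        G.frameIn_memberGlue_inB_eq_infFrame hR hR₀ hsrc hb rfl hy'

/-! ### §6 The framing is complementary to the tangent planes -/

omit [CompactSpace M] in
/-- The compactified member near a finite point is `memberU ∘ κ`; its differential.
[folklore] -/
theorem hasMFDerivAt_memberGlue_of_coordNeZero {y : ComplexProjectiveSpace 1} (hy : CoordNeZero 0 y)
    (hud : MDifferentiableAt 𝓘(ℝ, ℂ) (𝓡 4) u (affineCoordComplex 0 y 0)) :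
    HasMFDerivAt (𝓡 2) (𝓡 4) (G.memberGlue u b) y
      ((mfderiv 𝓘(ℝ, ℂ) (𝓡 4) u (affineCoordComplex 0 y 0)).comp
        (mfderiv (𝓡 2) 𝓘(ℝ, ℂ) (fun y : ComplexProjectiveSpace 1 => affineCoordComplex 0 y 0) y)) := by
  have hev : G.memberGlue u b =ᶠ[𝓝 y]
      (G.memberU u ∘ fun y : ComplexProjectiveSpace 1 => affineCoordComplex 0 y 0) := by
    filter_upwards [(isOpen_setOf_coordNeZero 0).mem_nhds hy] with y' hy'
    rw [comp_apply, memberU_apply]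
    exact G.memberGlue_of_coordNeZero_zero hy'
  exact ((G.hasMFDerivAt_memberU hud).comp y (hasMFDerivAt_affineCoordComplex_zero hy)).congr_of_eventuallyEq
    hev

omit [CompactSpace M] in
/-- The capped sphere near a finite point is `val ∘ u ∘ κ`; its differential (the same linear map).
[folklore] -/
theorem hasMFDerivAt_capGlue_of_coordNeZero {y : ComplexProjectiveSpace 1} (hy : CoordNeZero 0 y)
    (hud : MDifferentiableAt 𝓘(ℝ, ℂ) (𝓡 4) u (affineCoordComplex 0 y 0)) :
    HasMFDerivAt (𝓡 2) (𝓡 4) (capGlue u) y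
      ((mfderiv 𝓘(ℝ, ℂ) (𝓡 4) u (affineCoordComplex 0 y 0)).comp
        (mfderiv (𝓡 2) 𝓘(ℝ, ℂ) (fun y : ComplexProjectiveSpace 1 => affineCoordComplex 0 y 0) y)) := by
  have hev : capGlue u =ᶠ[𝓝 y]
      ((fun ξ => (u ξ).1) ∘ fun y : ComplexProjectiveSpace 1 => affineCoordComplex 0 y 0) := by
    filter_upwards [(isOpen_setOf_coordNeZero 0).mem_nhds hy] with y' hy'
    exact capGlue_of_coordNeZero_zero hy'
  exact ((hasMFDerivAt_val_comp hud).comp y (hasMFDerivAt_affineCoordComplex_zero hy)).congr_of_eventuallyEq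
    hev

omit [ChartedSpace (EuclideanSpace ℝ (Fin 4)) M] [IsManifold (𝓡 4) ∞ M] [CompactSpace M] in
/-- `‖e2c c‖ = ‖c‖`. [folklore] -/
theorem norm_e2c (c : EuclideanSpace ℝ (Fin 2)) : ‖e2c c‖ = ‖c‖ := by
  rw [EuclideanSpace.norm_eq, e2c_apply, Complex.norm_eq_sqrt_sq_add_sq, Fin.sum_univ_two,
    Real.norm_eq_abs, Real.norm_eq_abs, sq_abs, sq_abs]

omit [CompactSpace M] in
/-- **Complementarity at finite points.** If a frame vector `Ñ_y c` is tangent to the compactified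
member at a finite point `y`, then `c = 0`: on the core (`‖ξ‖ ≤ R`) because the Kirby framing is
complementary to the capped sphere, and on `‖ξ‖ ≥ R` by the tangent-killing functional and the
class equation. [cite: Wendl2018, proof of Prop. 2.53 (p. 65)] -/
theorem memberFraming_indep_of_coordNeZero (hu : IsPencilPlane J u b) (hR : 0 < R)
    (hbijN : ∀ y, Bijective ((mfderiv (𝓡 2) (𝓡 4) (capGlue u) y).coprod (N y)))
    (hA : Injective A)
    (hAn : ∀ c, (flatCx (N (CodimTwoData.linePt 1 0) (A c))).2 = e2c c)
    (hsrc : ∀ ξ : ℂ, R ≤ ‖ξ‖ → u ξ ∈ G.src)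
    (hest : ∀ ξ : ℂ, R ≤ ‖ξ‖ → InPuncturedChartBall p G.rad (u ξ) ∧
      DifferentiableAt ℂ (fun η : ℂ => pencilCoord p (u η)) ξ ∧
      ‖deriv (fun η : ℂ => (pencilCoord p (u η)).1) ξ - 1‖ ≤ 1 / 4 ∧
      ∀ c : EuclideanSpace ℝ (Fin 2),
        ‖tanKill (deriv (fun η : ℂ => (pencilCoord p (u η)).1) ξ)
            (deriv (fun η : ℂ => (pencilCoord p (u η)).2) ξ) (flatDeriv p (u ξ).1)
            (coreFrame p u N A ξ c) - (flatCx (N (CodimTwoData.linePt 1 0) (A c))).2‖ ≤ 1 / 4 * ‖c‖)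
    {y : ComplexProjectiveSpace 1} (hy : CoordNeZero 0 y) (c : EuclideanSpace ℝ (Fin 2))
    (a : TangentSpace (𝓡 2) y)
    (h : memberFraming p u N A R y c = mfderiv (𝓡 2) (𝓡 4) (G.memberGlue u b) y a) : c = 0 := by
  set ξ := affineCoordComplex 0 y 0 with hξ
  have hud : MDifferentiableAt 𝓘(ℝ, ℂ) (𝓡 4) u ξ := hu.mdifferentiableAt ξ
  rw [memberFraming_of_coordNeZero hy, (G.hasMFDerivAt_memberGlue_of_coordNeZero hy hud).mfderiv] at h
  by_cases hle : ‖ξ‖ ≤ R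
  · -- core: the Kirby framing is complementary to `dû = du ∘ dκ`
    rw [finiteFrame_of_norm_le hR hle, hξ, CodimTwoData.linePt_affineCoordComplex hy] at h
    have hDu : mfderiv (𝓡 2) (𝓡 4) (capGlue u) y a = N y (A c) := by
      rw [(hasMFDerivAt_capGlue_of_coordNeZero hy hud).mfderiv]
      exact h.symm
    have h2 : ((mfderiv (𝓡 2) (𝓡 4) (capGlue u) y).coprod (N y)) (a, -(A c)) = 0 := by
      rw [ContinuousLinearMap.coprod_apply, map_neg, hDu]
      exact add_neg_cancel (N y (A c))
    have h3 : (a, -(A c)) = 0 := (hbijN y).1 (h2.trans (map_zero _).symm)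
    have h4 : A c = 0 := by
      have := congrArg Prod.snd h3
      simpa using this
    exact hA (by rw [h4, map_zero])
  · -- interpolation and far zone: the tangent-killing functional
    have hRle : R ≤ ‖ξ‖ := (not_le.1 hle).le
    obtain ⟨hx, hd, hz, hcls⟩ := hest ξ hRle
    have hsrcξ : u ξ ∈ G.src := hsrc ξ hRle
    set zd := deriv (fun η : ℂ => (pencilCoord p (u η)).1) ξ with hzd
    set wd := deriv (fun η : ℂ => (pencilCoord p (u η)).2) ξ with hwd
    set Λ := tanKill zd wd (flatDeriv p (u ξ).1) with hΛ
    -- `Λ` kills the tangent vector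
    have h1 : Λ (finiteFrame p u N A R ξ c) = 0 := by
      rw [h]
      exact tanKill_flatDeriv_mfderiv hud hx.1 hd _
    -- `Λ` of the interpolated frame
    have h2 : Λ (finiteFrame p u N A R ξ c) =
        (1 - planeCutoff R ξ) • Λ (N (CodimTwoData.linePt 0 ξ) (A c)) + planeCutoff R ξ • (zd * e2c c) := by
      rw [finiteFrame_apply, map_add, map_smul, map_smul, G.tanKill_farFrame hsrcξ]
    -- `Λ` of the Kirby frame through the core frame
    have hlam : (0 : ℝ) < ‖recentre p (u ξ).1‖ ^ 2 :=
      pow_pos (norm_pos_iff.2 (extChartAt_sub_ne_zero (u ξ) hx.1)) 2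
    have h3 : Λ (N (CodimTwoData.linePt 0 ξ) (A c)) =
        (‖recentre p (u ξ).1‖ ^ 2)⁻¹ • Λ (coreFrame p u N A ξ c) := by
      rw [coreFrame_apply, map_smul, smul_smul, inv_mul_cancel₀ hlam.ne', one_smul]
    set Ecl : ℂ := Λ (coreFrame p u N A ξ c) - e2c c with hEcl
    have hcore : Λ (coreFrame p u N A ξ c) = e2c c + Ecl := by rw [hEcl]; ring
    have hE : ‖Ecl‖ ≤ ‖e2c c‖ / 4 := by
      have := hcls c
      rw [hAn c] at this
      rw [norm_e2c]
      linarith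
    have h4 : (((1 - planeCutoff R ξ) * (‖recentre p (u ξ).1‖ ^ 2)⁻¹ : ℝ) : ℂ) * (e2c c + Ecl) +
        (planeCutoff R ξ : ℂ) * (zd * e2c c) = 0 := by
      have h5 := h1
      rw [h2, h3, hcore, Complex.real_smul, Complex.real_smul, Complex.real_smul] at h5
      push_cast at h5 ⊢
      linear_combination h5
    have hw : e2c c = 0 :=
      eq_zero_of_classEquation (planeCutoff_nonneg R ξ) (planeCutoff_le_one R ξ) (inv_pos.2 hlam) hz hE h4
    exact e2c.injective (by rw [hw, map_zero])

/-- **Complementarity at `∞`.** The constant frame `flatCx⁻¹ (0, c)` is tangent to the compactified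
member at `∞` only for `c = 0` (the tangent plane there is `flatCx⁻¹ {(ζ, W'(0) ζ)}`).
[cite: Wendl2018, proof of Prop. 2.53 (p. 65)] -/
theorem memberFraming_indep_inf (hu : IsPencilPlane J u b) (hb : ‖b - G.b₀‖ < G.ρ')
    (hJstd : ∀ x : punctured p, InPuncturedChartBall p G.rad x →
      ∀ (v : TangentSpace (𝓡 4) x) (c : EuclideanSpace ℝ (Fin 4)),
        inner ℝ (fderiv ℝ inversion (extChartAt (𝓡 4) p x.1 - extChartAt (𝓡 4) p p)
          (mfderiv (𝓡 4) 𝓘(ℝ, EuclideanSpace ℝ (Fin 4))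
            (fun z : punctured p => extChartAt (𝓡 4) p z.1) x (J x v))) c
        = stdSymplecticForm (fderiv ℝ inversion (extChartAt (𝓡 4) p x.1 - extChartAt (𝓡 4) p p)
          (mfderiv (𝓡 4) 𝓘(ℝ, EuclideanSpace ℝ (Fin 4))
            (fun z : punctured p => extChartAt (𝓡 4) p z.1) x v)) c)
    (c : EuclideanSpace ℝ (Fin 2)) (a : TangentSpace (𝓡 2) (CodimTwoData.linePt 1 0))
    (h : memberFraming p u N A R (CodimTwoData.linePt 1 0) c =
      mfderiv (𝓡 2) (𝓡 4) (G.memberGlue u b) (CodimTwoData.linePt 1 0) a) : c = 0 := by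
  have hidx := chartIndex_linePt_one_zero
  have h0 : affineCoordComplex 1 (CodimTwoData.linePt 1 0) 0 = 0 := CodimTwoData.affineCoordComplex_linePt 1 0
  have hG' : ∀ q, CoordNeZero (chartIndex (CodimTwoData.linePt 1 0)) q →
      G.memberGlue u b q = G.memberV u b (affineCoordComplex (chartIndex (CodimTwoData.linePt 1 0)) q 0) := by
    rw [hidx]; exact fun q hq => G.memberGlue_of_coordNeZero_one hq
  have hw : MDifferentiableAt 𝓘(ℝ, ℂ) (𝓡 4) (G.memberV u b)
      (affineCoordComplex (chartIndex (CodimTwoData.linePt 1 0)) (CodimTwoData.linePt 1 0) 0) := by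
    rw [hidx, h0]; exact (G.contMDiff_memberV hu hb hJstd 0).mdifferentiableAt (by simp)
  have hd := hasMFDerivAt_glued (w := G.memberV u b) (CodimTwoData.linePt 1 0) hG' hw
  rw [hidx, h0, (G.hasMFDerivAt_memberV_zero hu hb hJstd).mfderiv] at hd
  have hm : mfderiv (𝓡 2) (𝓡 4) (G.memberGlue u b) (CodimTwoData.linePt 1 0) = _ := hd.mfderiv
  rw [hm, memberFraming_of_not_coordNeZero CodimTwoData.not_coordNeZero_zero_linePt_one_zero] at h
  -- `flatCx⁻¹ (0, e2c c) = flatCx⁻¹ (memberXWDeriv ζ)`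
  set ζ : ℂ := ((ContinuousLinearMap.proj (0 : Fin 1) : (Fin 1 → ℂ) →L[ℝ] ℂ).comp
    (realCoordinates 1).symm.toContinuousLinearMap) a with hζ
  have h1 : ((0 : ℂ), e2c c) = memberXWDeriv u b ζ := by
    apply flatCx.symm.injective
    exact h
  have h2 : ζ = 0 := by
    have := congrArg Prod.fst h1
    rw [memberXWDeriv_apply_fst] at this
    exact this.symm
  rw [h2, map_zero] at h1
  have h3 : e2c c = 0 := by
    have := congrArg Prod.snd h1
    simpa using this
  exact e2c.injective (by rw [h3, map_zero])

/-- **The normal framing is complementary to the tangent planes of the compactified member**: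
`dc̃_y ⊕ Ñ_y : ℝ² × ℝ² → T_{c̃ y} Y` is bijective for every `y`.
[cite: Wendl2018, proof of Prop. 2.53 (p. 65)] -/
theorem bijective_coprod_memberFraming (hu : IsPencilPlane J u b) (hb : ‖b - G.b₀‖ < G.ρ')
    (hJstd : ∀ x : punctured p, InPuncturedChartBall p G.rad x →
      ∀ (v : TangentSpace (𝓡 4) x) (c : EuclideanSpace ℝ (Fin 4)),
        inner ℝ (fderiv ℝ inversion (extChartAt (𝓡 4) p x.1 - extChartAt (𝓡 4) p p)
          (mfderiv (𝓡 4) 𝓘(ℝ, EuclideanSpace ℝ (Fin 4))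
            (fun z : punctured p => extChartAt (𝓡 4) p z.1) x (J x v))) c
        = stdSymplecticForm (fderiv ℝ inversion (extChartAt (𝓡 4) p x.1 - extChartAt (𝓡 4) p p)
          (mfderiv (𝓡 4) 𝓘(ℝ, EuclideanSpace ℝ (Fin 4))
            (fun z : punctured p => extChartAt (𝓡 4) p z.1) x v)) c)
    (hR : 0 < R) (hbijN : ∀ y, Bijective ((mfderiv (𝓡 2) (𝓡 4) (capGlue u) y).coprod (N y)))
    (hA : Injective A)
    (hAn : ∀ c, (flatCx (N (CodimTwoData.linePt 1 0) (A c))).2 = e2c c)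
    (hsrc : ∀ ξ : ℂ, R ≤ ‖ξ‖ → u ξ ∈ G.src)
    (hest : ∀ ξ : ℂ, R ≤ ‖ξ‖ → InPuncturedChartBall p G.rad (u ξ) ∧
      DifferentiableAt ℂ (fun η : ℂ => pencilCoord p (u η)) ξ ∧
      ‖deriv (fun η : ℂ => (pencilCoord p (u η)).1) ξ - 1‖ ≤ 1 / 4 ∧
      ∀ c : EuclideanSpace ℝ (Fin 2),
        ‖tanKill (deriv (fun η : ℂ => (pencilCoord p (u η)).1) ξ)
            (deriv (fun η : ℂ => (pencilCoord p (u η)).2) ξ) (flatDeriv p (u ξ).1)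
            (coreFrame p u N A ξ c) - (flatCx (N (CodimTwoData.linePt 1 0) (A c))).2‖ ≤ 1 / 4 * ‖c‖)
    (y : ComplexProjectiveSpace 1) :
    Bijective ((mfderiv (𝓡 2) (𝓡 4) (G.memberGlue u b) y).coprod (memberFraming p u N A R y)) := by
  refine bijective_coprod_of_eq ((G.memberGlue_smooth_injective_immersion hu hb hJstd).2.2 y)
    fun c a h => ?_
  by_cases hy : CoordNeZero 0 y
  · exact G.memberFraming_indep_of_coordNeZero hu hR hbijN hA hAn hsrc hest hy c a h
  · have hy' := CodimTwoData.eq_linePt_one_zero hy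
    subst hy'
    exact G.memberFraming_indep_inf hu hb hJstd c a h

/-! ### §7 The tube and the defining submersion -/

omit [IsManifold (𝓡 4) ∞ M] in
/-- From the tube radius `r` of `exists_memberV_radius`: the member lies in the gluing region
outside the disc of radius `r⁻¹`. [folklore] -/
theorem exists_src_radius (hu : IsPencilPlane J u b) (hb : ‖b - G.b₀‖ < G.ρ') :
    ∃ R₀ : ℝ, ∀ ξ : ℂ, R₀ < ‖ξ‖ → u ξ ∈ G.src := by
  obtain ⟨r, hr, hsrc⟩ := G.exists_memberV_radius hu hb
  refine ⟨r⁻¹, fun ξ hξ => ?_⟩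
  have hξ0 : ξ ≠ 0 := by
    rintro rfl
    rw [norm_zero] at hξ
    exact (lt_irrefl _ (lt_trans (inv_pos.2 hr) hξ)).elim
  have h1 : ‖ξ⁻¹‖ < r := by
    rw [norm_inv]
    exact (inv_lt_comm₀ (norm_pos_iff.2 hξ0) hr).2 hξ
  have := (hsrc ξ⁻¹ (inv_ne_zero hξ0) h1).1
  rwa [inv_inv] at this

/-- **The compactified member has trivial normal bundle in `Y`** (Wendl 2018, proof of Prop. 2.53,
p. 65: the normal bundle of the proper transform of a member in the blown-up end is trivial; here
for `M` a compact homotopy `4`-sphere, via Kirby's Theorem VIII.2 on the core and the flat frame at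
infinity): there are an open `N ⊆ Y` containing the sphere and `π : Y → ℂ`, `C^∞` with surjective
differential on `N`, with `N ∩ π⁻¹(0)` exactly the sphere — the trivial-normal-bundle hypothesis of
`hls_localFoliation_embeddedSphere_trivialNormal`. [cite: Wendl2018, proof of Prop. 2.53 (p. 65)] -/
theorem exists_trivialNormal_memberGlue [SecondCountableTopology M]
    (hM : Nonempty (ContinuousMap.HomotopyEquiv M (sphere (0 : EuclideanSpace ℝ (Fin 5)) 1)))
    (hu : IsPencilPlane J u b) (hb : ‖b - G.b₀‖ < G.ρ')
    (hJstd : ∀ x : punctured p, InPuncturedChartBall p G.rad x →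
      ∀ (v : TangentSpace (𝓡 4) x) (c : EuclideanSpace ℝ (Fin 4)),
        inner ℝ (fderiv ℝ inversion (extChartAt (𝓡 4) p x.1 - extChartAt (𝓡 4) p p)
          (mfderiv (𝓡 4) 𝓘(ℝ, EuclideanSpace ℝ (Fin 4))
            (fun z : punctured p => extChartAt (𝓡 4) p z.1) x (J x v))) c
        = stdSymplecticForm (fderiv ℝ inversion (extChartAt (𝓡 4) p x.1 - extChartAt (𝓡 4) p p)
          (mfderiv (𝓡 4) 𝓘(ℝ, EuclideanSpace ℝ (Fin 4))
            (fun z : punctured p => extChartAt (𝓡 4) p z.1) x v)) c) :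
    ∃ (Nset : Set G.Y) (π : G.Y → ℂ), IsOpen Nset ∧
      range (G.memberU u) ∪ {G.memberV u b 0} ⊆ Nset ∧
      ContMDiffOn (𝓡 4) 𝓘(ℝ, ℂ) ∞ π Nset ∧
      (∀ y ∈ Nset, Surjective (mfderiv (𝓡 4) 𝓘(ℝ, ℂ) π y)) ∧
      {y | y ∈ Nset ∧ π y = 0} = range (G.memberU u) ∪ {G.memberV u b 0} := by
  -- the sphere, the capped sphere and its Kirby framing
  obtain ⟨hcs, hci, hcd⟩ := G.memberGlue_smooth_injective_immersion hu hb hJstd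
  obtain ⟨hus, hui, hud⟩ := hu.capGlue_smooth_injective_immersion G.rad_pos hJstd
  obtain ⟨N, hN, hbijN⟩ := exists_normalFraming_of_homotopyEquiv_sphere_four hM (capGlue u) hus hui hud
  have hbinf : Bijective (sndFlat (N (CodimTwoData.linePt 1 0))) :=
    hu.bijective_sndFlat_frame_inf G.rad_pos hJstd (hbijN (CodimTwoData.linePt 1 0))
  set Aeq := frameNormaliser (N (CodimTwoData.linePt 1 0)) hbinf with hAeq
  set A : EuclideanSpace ℝ (Fin 2) →L[ℝ] EuclideanSpace ℝ (Fin 2) :=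
    (Aeq : EuclideanSpace ℝ (Fin 2) →L[ℝ] EuclideanSpace ℝ (Fin 2)) with hA
  have hAinj : Injective A := Aeq.injective
  have hAn : ∀ c, (flatCx (N (CodimTwoData.linePt 1 0) (A c))).2 = e2c c := fun c =>
    sndFlat_frameNormaliser _ hbinf c
  -- radii
  obtain ⟨R₀, hsrc⟩ := G.exists_src_radius hu hb
  have hev := hu.eventually_tanKill_coreFrame G.rad_pos hJstd hN A (δ := 1 / 4) (by norm_num)
  obtain ⟨R', hR'⟩ := exists_forall_norm_le_of_eventually_cocompact hev
  set R : ℝ := max (max R₀ R') 0 + 1 with hRdef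
  have hR : 0 < R := by rw [hRdef]; have := le_max_right (max R₀ R') 0; linarith
  have hR₀R : R₀ < R := by
    rw [hRdef]; have := (le_max_left R₀ R').trans (le_max_left _ (0 : ℝ)); linarith
  have hR'R : R' ≤ R := by
    rw [hRdef]; have := (le_max_right R₀ R').trans (le_max_left _ (0 : ℝ)); linarith
  have hsrcR : ∀ ξ : ℂ, R ≤ ‖ξ‖ → u ξ ∈ G.src := fun ξ hξ => hsrc ξ (lt_of_lt_of_le hR₀R hξ)
  have hest : ∀ ξ : ℂ, R ≤ ‖ξ‖ → InPuncturedChartBall p G.rad (u ξ) ∧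
      DifferentiableAt ℂ (fun η : ℂ => pencilCoord p (u η)) ξ ∧
      ‖deriv (fun η : ℂ => (pencilCoord p (u η)).1) ξ - 1‖ ≤ 1 / 4 ∧
      ∀ c : EuclideanSpace ℝ (Fin 2),
        ‖tanKill (deriv (fun η : ℂ => (pencilCoord p (u η)).1) ξ)
            (deriv (fun η : ℂ => (pencilCoord p (u η)).2) ξ) (flatDeriv p (u ξ).1)
            (coreFrame p u N A ξ c) - (flatCx (N (CodimTwoData.linePt 1 0) (A c))).2‖ ≤ 1 / 4 * ‖c‖ :=
    fun ξ hξ => hR' ξ (hR'R.trans hξ)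
  -- the framing, smooth along and complementary
  have hÑ : IsSmoothAlong (𝓡 2) (G.memberGlue u b) (memberFraming p u N A R) :=
    G.isSmoothAlong_memberFraming hu hb hJstd hN hR hR₀R hsrc
  have hbij : ∀ y, Bijective ((mfderiv (𝓡 2) (𝓡 4) (G.memberGlue u b) y).coprod
      (memberFraming p u N A R y)) :=
    G.bijective_coprod_memberFraming hu hb hJstd hR hbijN hAinj hAn hsrcR hest
  -- the tube
  obtain ⟨ν, hν, hνo, hν0⟩ := exists_isSmoothEmbedding_tube_of_isSmoothAlong (IM := 𝓡 2)
    (F := EuclideanSpace ℝ (Fin 2)) hcs hci hÑ hbij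
  have hinj : Injective ν := hν.isEmbedding.injective
  set g : G.Y → ComplexProjectiveSpace 1 × EuclideanSpace ℝ (Fin 2) := invFun ν with hg
  have hgl : LeftInverse g ν := leftInverse_invFun hinj
  set π : G.Y → ℂ := fun y => e2c (g y).2 with hπ
  have hgs : ContMDiffOn (𝓡 4) ((𝓡 2).prod 𝓘(ℝ, EuclideanSpace ℝ (Fin 2))) ∞ g (range ν) :=
    contMDiffOn_leftInverse_of_isImmersion hν.isImmersion hν.isEmbedding hgl
  have hπs : ContMDiffOn (𝓡 4) 𝓘(ℝ, ℂ) ∞ π (range ν) :=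
    (e2c : EuclideanSpace ℝ (Fin 2) →L[ℝ] ℂ).contMDiff.comp_contMDiffOn
      (contMDiff_snd.comp_contMDiffOn hgs)
  have hπν : ∀ q, π (ν q) = e2c q.2 := fun q => by simp only [hπ, hgl q]
  have hrange : range (G.memberGlue u b) = range (G.memberU u) ∪ {G.memberV u b 0} := G.range_memberGlue
  refine ⟨range ν, π, hνo, ?_, hπs, ?_, ?_⟩
  · rw [← hrange]
    rintro _ ⟨x, rfl⟩
    exact ⟨(x, 0), hν0 x⟩
  · rintro _ ⟨q, rfl⟩
    -- `π ∘ ν = e2c ∘ pr₂`, whose differential is onto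
    have hνd : MDifferentiableAt ((𝓡 2).prod 𝓘(ℝ, EuclideanSpace ℝ (Fin 2))) (𝓡 4) ν q :=
      (hν.contMDiff q).mdifferentiableAt (by simp)
    have hπd : MDifferentiableAt (𝓡 4) 𝓘(ℝ, ℂ) π (ν q) :=
      (hπs.contMDiffAt (hνo.mem_nhds ⟨q, rfl⟩)).mdifferentiableAt (by simp)
    have hcomp := mfderiv_comp q hπd hνd
    have hfun : π ∘ ν = fun q : ComplexProjectiveSpace 1 × EuclideanSpace ℝ (Fin 2) => e2c q.2 :=
      funext hπν
    have h2 : HasMFDerivAt ((𝓡 2).prod 𝓘(ℝ, EuclideanSpace ℝ (Fin 2))) 𝓘(ℝ, ℂ)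
        (fun q : ComplexProjectiveSpace 1 × EuclideanSpace ℝ (Fin 2) => e2c q.2) q
        ((e2c : EuclideanSpace ℝ (Fin 2) →L[ℝ] ℂ).comp
          (ContinuousLinearMap.snd ℝ (EuclideanSpace ℝ (Fin 2)) (EuclideanSpace ℝ (Fin 2)))) :=
      (e2c : EuclideanSpace ℝ (Fin 2) →L[ℝ] ℂ).hasFDerivAt.hasMFDerivAt.comp q
        (hasMFDerivAt_snd (I := 𝓡 2) (I' := 𝓘(ℝ, EuclideanSpace ℝ (Fin 2))) (x := q))
    rw [hfun] at hcomp
    have hsurj : Surjective (mfderiv ((𝓡 2).prod 𝓘(ℝ, EuclideanSpace ℝ (Fin 2))) 𝓘(ℝ, ℂ)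
        (fun q : ComplexProjectiveSpace 1 × EuclideanSpace ℝ (Fin 2) => e2c q.2) q) := by
      rw [h2.mfderiv]
      exact e2c.surjective.comp fun v => ⟨(0, v), rfl⟩
    rw [hcomp] at hsurj
    intro w
    obtain ⟨v, hv⟩ := hsurj w
    exact ⟨mfderiv ((𝓡 2).prod 𝓘(ℝ, EuclideanSpace ℝ (Fin 2))) (𝓡 4) ν q v, hv⟩
  · ext y
    constructor
    · rintro ⟨⟨q, rfl⟩, hπ0⟩
      have hq : q.2 = 0 := e2c.injective (by rw [← hπν q, map_zero]; exact hπ0)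
      rw [← hrange]
      refine ⟨q.1, ?_⟩
      rw [← hν0 q.1]
      obtain ⟨q1, q2⟩ := q
      simp only at hq
      rw [hq]
    · intro hy
      rw [← hrange] at hy
      obtain ⟨x, rfl⟩ := hy
      refine ⟨⟨(x, 0), hν0 x⟩, ?_⟩
      rw [← hν0 x, hπν]
      exact map_zero _

end PencilEnd

end Literature.Geometry.Symplectic
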